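import Summits.QuantumFields.YangMills.Theorems.BalabanUVNodesN14SourceTowerOfRecord
import Summits.QuantumFields.YangMills.Theorems.BalabanUVNodesN14DressedTowerGuardAx

/-!
# DAG node N14 · NE1′ — THE SOURCE TOWER OF RECORD READ FROM THE χ-GENERIC DATUM (`ne1OfRecordChi`, Ax instance `ne1OfRecordAx`), `N14At` ON IT, THE GUARD OF RECORD,
# AND THE (t-N14) PIN SHAPE AT A CENTRE-MAP-GENERIC («Cmap») STAGE-13 RATE READING — op 5c supply row R9 for crux K3ᴬ `SpineGivenEndpointR13SepCoPHVAx`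
# (stmt-QuantumFields-27247; plan g99 `D99-KAX/OP5C-SUPPLY-CENSUS-K3v8.md` §2 row 9)

Cell `pub-ymgap`, seat `pub-ymgap-dag-n16-e` (R134 (a); dag-lead g40 HANDS-4a R9 — no n14 seat live), generation 30.  `--supports stmt-QuantumFields-27247 --as helper`
(count-neutral).  NEW basename beside the UNTOUCHED parent `Thm/BalabanUVNodesN14SourceTowerOfRecord` (dag-n14-w1 FILE 3, ns `YMDAG.N14.TopBorn`); the [Ax-3c]∕[Ax-3d]
pattern (node00-def-RR-2 g26 Q-TRANSPORT answer (3) «cheapest shape»): the parent's DATUM-BOUND object `ne1OfRecord l₀ Λ F θ hP g₀ os := ⟨_, sourceTowerOfRecord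
((datumOfRecord₁₃CoPH F N θ hP).scheme g₀) l₀ os, Λ⟩` re-issued over the χ-GENERIC datum `datumOfRecord₁₃CoPHChi F N θ χ hP` ([Ax-3c] `Node00/Record13CoPHChi` :391) as
`ne1OfRecordChi`, with `abbrev ne1OfRecordAx` (instance `χ := chiβOfRecord₁₃Ax θ`) and the receipt `ne1OfRecordChi_chiβ : … = ne1OfRecord …` (`rfl` at the record's β-slot);
§5 of the parent (sizes, `N14At`, the guard, rate clause, budget) VERBATIM over it — every proof is datum-generic (`FiniteEpsData.abs_avgObs_le_one`, `obsSupNorm_scheme_zero`);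
§6's READING-BOUND declarations over `(𝔯 : RateReading₁₃CoPHCmap N Χ)`: the pin shape `Ne1PinnedOfRecordCmap` (+ `abbrev Ne1PinnedOfRecordAx`; K3 v7 use-sites
`GuardedReading`, `ne1PinnedOfRecord_iff`), `ne1PinnedOfRecordCmap_mk` (A6), the GUARD half of `guard_and_s_N14_of_ne1PinnedOfRecord` (`ne1NondegenerateOnCmap_of_ne1PinnedOfRecord`;
the `S_N14 (RRec₁₃CoPHOn 𝔯 Rg)` half follows the Cmap home predicate), `n14At_rateCarriersCmap_of_pinned` (use-site `n14At_rrOfRecord_of_pinned`),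
`nondegenerate_rateCarriersCmap_of_pinned`.

HONEST FRAMING.  Definitions re-issued over a parameter + kernel bookkeeping by name; `N14At` on the object of record is the observable budget from `|avgObs| ≤ 1` (reading (a),
director-ym №195 (8)) — N14 NOT discharged by this; nothing of Bałaban's densities asserted; NE1′ NOT printed for d = 4 and NOT proved; K3ᴬ OPEN (skeleton unregistered at
filing); counts UNMOVED (typed 28∕28 · discharged 8∕27, A 8∕28); no `sorry`∕`instance`∕`notation`; standard axioms; one finite four-torus at fixed ε — NOT ℝ⁴ ∕ infinite
volume ∕ OS ∕ mass gap ∕ Clay.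
-/

set_option autoImplicit false

noncomputable section

namespace YMDAG.N14.TopBorn

open Finset
open scoped BigOperators
open Literature.MathematicalPhysics.QuantumFieldTheory.Balaban1983to89
open Literature.MathematicalPhysics.QuantumFieldTheory.Balaban1983to89.T4Continuum
open Literature.MathematicalPhysics.QuantumFieldTheory.Balaban1983to89.T4TermFormat
open Literature.MathematicalPhysics.QuantumFieldTheory.Balaban1983to89.T4GenFunBounds (prodObs)
open Summit.QuantumFields.BalabanUV.T4Continuum.NE1p.DressedRoot
open YMDAG.UVSplit
open YMDAG.N14.TowerGuard (Nondegenerate NondegeneratePerScale RateCovers Ne1NondegenerateOnCmap dressedBudget_of_n14At_rateCovers)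
open Node00 (Stage13Params Stage13HParams ChiSlot RateObjects₁₁ chiβOfRecord₁₃ chiβOfRecord₁₃Ax datumOfRecord₁₃CoPH datumOfRecord₁₃CoPHChi provisos₁₃CoPHChi_chiβ_iff)

/-! ## §1 THE N14 OBJECT OF RECORD READ FROM THE χ-GENERIC DATUM (`datumOfRecord₁₃CoPHChi`), with the Ax instance and the receipt -/

section Record
variable {N : ℕ} [NeZero N]

/-- **THE SOURCE TOWER OF RECORD READ FROM THE χ-GENERIC DATUM** [object of record]: VERBATIM `ne1OfRecord` with `datumOfRecord₁₃CoPH F N θ hP ↦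
datumOfRecord₁₃CoPHChi F N θ χ hP` ([Ax-3c] `Node00/Record13CoPHChi` :391).  Letters `l₀`, `Λ`; everything else READ. [folklore] -/
def ne1OfRecordChi (l₀ Λ : ℝ) (F : T4Family) (θ : Stage13HParams F N) (χ : ChiSlot F N) (hP : θ.Provisos₁₃CoPHChi F N χ) (g₀ : ℕ → ℝ) (os : List (ULoop F)) :
    NE1pCarriers :=
  ⟨{t : ℝ // |t| ≤ l₀}, sourceTowerOfRecord ((datumOfRecord₁₃CoPHChi F N θ χ hP).scheme g₀) l₀ os, Λ⟩

/-- **The source tower of record read from the RE-CENTRED datum** (instance `χ := chiβOfRecord₁₃Ax θ`). [folklore] -/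
abbrev ne1OfRecordAx (l₀ Λ : ℝ) (F : T4Family) (θ : Stage13HParams F N) (hP : θ.Provisos₁₃CoPHAx F N) (g₀ : ℕ → ℝ) (os : List (ULoop F)) : NE1pCarriers :=
  ne1OfRecordChi l₀ Λ F θ (chiβOfRecord₁₃Ax F N θ.toStage13Params) hP g₀ os

/-- Receipt: at the record's β-slot the χ-generic object IS the parent's `ne1OfRecord` (definitional, through `datumOfRecord₁₃CoPHChi_chiβ`). [folklore] -/
theorem ne1OfRecordChi_chiβ (l₀ Λ : ℝ) (F : T4Family) (θ : Stage13HParams F N) (hP : θ.Provisos₁₃CoPH F N) (g₀ : ℕ → ℝ) (os : List (ULoop F)) :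
    ne1OfRecordChi l₀ Λ F θ (chiβOfRecord₁₃ F N θ.toStage13Params) ((provisos₁₃CoPHChi_chiβ_iff θ).2 hP) g₀ os = ne1OfRecord l₀ Λ F θ hP g₀ os := rfl

variable {l₀ Λ : ℝ} (F : T4Family) (θ : Stage13HParams F N) (χ : ChiSlot F N) (hP : θ.Provisos₁₃CoPHChi F N χ) (g₀ : ℕ → ℝ) (os : List (ULoop F))

/-- The booked size at source `t`, cutoff `K` IS `|t| · sup_U |∏ avgObs_K(C)(U)|` at the χ-generic datum (`rfl`). [folklore] -/
theorem size_ne1OfRecordChi (t : {t : ℝ // |t| ≤ l₀}) (K : ℕ) (b : Unit) (k : ℕ) :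
    ((ne1OfRecordChi l₀ Λ F θ χ hP g₀ os).𝒯.B t K).size b k = |t.1| * obsSupNorm ((datumOfRecord₁₃CoPHChi F N θ χ hP).scheme g₀) K os := rfl

/-- `|t · F_K U| ≤ size`, every `U`, NO hypothesis (normalized traces). [folklore] -/
theorem abs_exponent_le_size_ne1OfRecordChi (t : {t : ℝ // |t| ≤ l₀}) (K : ℕ) (b : Unit) (k : ℕ) (U : GaugeField (F.P K) 0 (SU N)) :
    |t.1 * prodObs ((datumOfRecord₁₃CoPHChi F N θ χ hP).scheme g₀) K os U| ≤ ((ne1OfRecordChi l₀ Λ F θ χ hP g₀ os).𝒯.B t K).size b k :=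
  abs_exponent_le_size (S := (datumOfRecord₁₃CoPHChi F N θ χ hP).scheme g₀) (l₀ := l₀) (os := os)
    (fun K C U => (datumOfRecord₁₃CoPHChi F N θ χ hP).abs_avgObs_le_one K C U) t K b k U

/-- The object is top-born. [folklore] -/
theorem towerTopBorn_ne1OfRecordChi : TowerTopBorn (ne1OfRecordChi l₀ Λ F θ χ hP g₀ os).𝒯 :=
  towerTopBorn_sourceTowerOfRecord _ l₀ os

/-- Top sizes `≤ l₀`, NO hypothesis. [folklore] -/
theorem towerTopSizeLe_ne1OfRecordChi : TowerTopSizeLe (ne1OfRecordChi l₀ Λ F θ χ hP g₀ os).𝒯 l₀ :=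
  towerTopSizeLe_sourceTowerOfRecord _ l₀ os fun K C U => (datumOfRecord₁₃CoPHChi F N θ χ hP).abs_avgObs_le_one K C U

/-- **ROOT-C OF RECORD ON THE χ-GENERIC OBJECT OF RECORD, AT EVERY TUPLE**: `N14At` for `0 ≤ l₀`, `0 ≤ Λ` — from the datum's own loop-variable bound. [folklore] -/
theorem n14At_ne1OfRecordChi (hl₀ : 0 ≤ l₀) (hΛ : 0 ≤ Λ) : N14At (ne1OfRecordChi l₀ Λ F θ χ hP g₀ os) :=
  n14At_sourceTowerOfRecord _ l₀ os (fun K C U => (datumOfRecord₁₃CoPHChi F N θ χ hP).abs_avgObs_le_one K C U) hl₀ hΛ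

/-- **THE GUARD OF RECORD PASSES** for `0 < l₀` at EVERY tuple (at cutoff `0` the insertion at `t = l₀` books `l₀ · 1 > 0`). [folklore] -/
theorem nondegenerate_ne1OfRecordChi (hl₀ : 0 < l₀) : Nondegenerate (ne1OfRecordChi l₀ Λ F θ χ hP g₀ os) :=
  ⟨nonempty_sourceWindow hl₀.le, birthsNonempty_sourceTowerOfRecord _ l₀ os,
    notVacuum_sourceTowerOfRecord_of_pos _ l₀ os hl₀ (K := 0) (by
      rw [obsSupNorm_scheme_zero]
      exact one_pos)⟩

/-- The χ-generic object passes the guard of record IFF `0 < l₀`. [folklore] -/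
theorem nondegenerate_ne1OfRecordChi_iff : Nondegenerate (ne1OfRecordChi l₀ Λ F θ χ hP g₀ os) ↔ 0 < l₀ :=
  ⟨fun h => pos_of_nondegenerate_sourceTowerOfRecord _ l₀ os h, fun h => nondegenerate_ne1OfRecordChi F θ χ hP g₀ os h⟩

/-- … and FAILS the per-scale variant (top-born). [folklore] -/
theorem not_nondegeneratePerScale_ne1OfRecordChi (hl₀ : 0 ≤ l₀) : ¬ NondegeneratePerScale (ne1OfRecordChi l₀ Λ F θ χ hP g₀ os) := fun h =>
  haveI : Nonempty (ne1OfRecordChi l₀ Λ F θ χ hP g₀ os).P := nonempty_sourceWindow hl₀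
  not_memberPerScale_of_topBorn (towerTopBorn_ne1OfRecordChi F θ χ hP g₀ os) h.2.1

/-- The rate clause at multiplicity `1`, every `Λ ≥ 0`. [folklore] -/
theorem rateCovers_ne1OfRecordChi (hΛ : 0 ≤ Λ) : RateCovers (ne1OfRecordChi l₀ Λ F θ χ hP g₀ os) 1 :=
  rateCovers_sourceTowerOfRecord _ l₀ os hΛ

/-- **ROOT-B ON THE χ-GENERIC OBJECT OF RECORD**: `DressedBudget` for every run-weight profile in `[0, w̄]`. [folklore] -/
theorem dressedBudget_ne1OfRecordChi (hl₀ : 0 ≤ l₀) (hΛ : 0 ≤ Λ) {wbar : ℝ} {w : {t : ℝ // |t| ≤ l₀} → ℕ → ℕ → ℝ} (hwbar : 0 ≤ wbar)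
    (hw0 : ∀ p K, ∀ j ≤ K, 0 ≤ w p K j) (hwb : ∀ p K, ∀ j ≤ K, w p K j ≤ wbar) : DressedBudget (ne1OfRecordChi l₀ Λ F θ χ hP g₀ os).𝒯 w :=
  dressedBudget_of_n14At_rateCovers (c := ne1OfRecordChi l₀ Λ F θ χ hP g₀ os) (n14At_ne1OfRecordChi F θ χ hP g₀ os hl₀ hΛ)
    (rateCovers_ne1OfRecordChi F θ χ hP g₀ os hΛ) hwbar hw0 hwb

end Record

/-! ## §2 Reading level at a centre-map-generic reading: the pin shape, the guard and the N14 conjunct in the bundle currency -/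

section Reading
variable {N : ℕ} [NeZero N] {Χ : (F : T4Family) → Stage13Params F N → ChiSlot F N} (𝔯 : RateReading₁₃CoPHCmap N Χ)
  (Rg : (F : T4Family) → Stage13HParams F N → Prop) {l₀ Λ : ℝ}

/-- **THE KEYED GUARD OF RECORD AT EVERY REGIME** for a centre-map-generic reading whose `ne1` is the χ-generic object of record at `χ := Χ F θ`, `0 < l₀`. [folklore] -/
theorem ne1NondegenerateOnCmap_of_ne1OfRecordChi (hl₀ : 0 < l₀)
    (h : ∀ (F : T4Family) (θ : Stage13HParams F N) (hP : θ.Provisos₁₃CoPHChi F N (Χ F θ.toStage13Params)) (g₀ : ℕ → ℝ) (os : List (ULoop F)),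
      𝔯.ne1 F θ hP g₀ os = ne1OfRecordChi l₀ Λ F θ (Χ F θ.toStage13Params) hP g₀ os) :
    Ne1NondegenerateOnCmap 𝔯 Rg := fun F θ hP _ _ g₀ os => by
  rw [h F θ hP g₀ os]
  exact nondegenerate_ne1OfRecordChi F θ _ hP g₀ os hl₀

/-- **THE (t-N14) PIN SHAPE AT A CENTRE-MAP-GENERIC READING** [shape]: VERBATIM `Ne1PinnedOfRecord` with the object of record read from the χ-generic datum at the
reading's centre map — the K3ᴬ v8 skeleton's `GuardedReading` first conjunct at `Χ := chiβOfRecord₁₃Ax`. [folklore] -/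
def Ne1PinnedOfRecordCmap (𝔯 : RateReading₁₃CoPHCmap N Χ) : Prop :=
  ∃ l₀ Λ : ℝ, 0 < l₀ ∧ 0 ≤ Λ ∧
    ∀ (F : T4Family) (θ : Stage13HParams F N) (hP : θ.Provisos₁₃CoPHChi F N (Χ F θ.toStage13Params)) (g₀ : ℕ → ℝ) (os : List (ULoop F)),
      𝔯.ne1 F θ hP g₀ os = ne1OfRecordChi l₀ Λ F θ (Χ F θ.toStage13Params) hP g₀ os

/-- **The pin at the RE-CENTRED reading** (instance `Χ := chiβOfRecord₁₃Ax`; the pinned object is `ne1OfRecordAx l₀ Λ`). [folklore] -/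
abbrev Ne1PinnedOfRecordAx (𝔯 : RateReading₁₃CoPHAx N) : Prop := Ne1PinnedOfRecordCmap 𝔯

/-- **THE PIN IS INHABITED** (A6): the reading with any `lit` and `ne1 := ne1OfRecordChi l₀ Λ … (Χ F θ) …`, `0 < l₀`, `0 ≤ Λ`, carries it (`rfl`). [folklore] -/
theorem ne1PinnedOfRecordCmap_mk
    (lit : (F : T4Family) → (θ : Stage13HParams F N) → θ.Provisos₁₃CoPHChi F N (Χ F θ.toStage13Params) → (ℕ → ℝ) → List (ULoop F) → RateObjects₁₁ N)
    (hl₀ : 0 < l₀) (hΛ : 0 ≤ Λ) :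
    Ne1PinnedOfRecordCmap (⟨lit, fun F θ hP g₀ os => ne1OfRecordChi l₀ Λ F θ (Χ F θ.toStage13Params) hP g₀ os⟩ : RateReading₁₃CoPHCmap N Χ) :=
  ⟨l₀, Λ, hl₀, hΛ, fun _ _ _ _ _ => rfl⟩

/-- **UNDER THE PIN: THE KEYED GUARD OF RECORD AT EVERY REGIME** (the guard half of the parent's `guard_and_s_N14_of_ne1PinnedOfRecord` — what the K3ᴬ skeleton's
`ne1NondegenerateOn_of_guardedReading` reads; the `S_N14 (RRec₁₃CoPHOn …)` half waits for the Cmap home predicate). [folklore] -/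
theorem ne1NondegenerateOnCmap_of_ne1PinnedOfRecord (h : Ne1PinnedOfRecordCmap 𝔯) : Ne1NondegenerateOnCmap 𝔯 Rg := by
  obtain ⟨l₀, Λ, hl₀, -, hpin⟩ := h
  exact ne1NondegenerateOnCmap_of_ne1OfRecordChi 𝔯 Rg hl₀ hpin

/-- **UNDER THE PIN: THE N14 CONJUNCT IN THE BUNDLE CURRENCY**: `N14At (rateCarriersOfRecord₁₃CoPHCmap 𝔯 F θ hP g₀ os k).ne1` at EVERY tuple and run length — the
K3ᴬ skeleton's `n14At_rrOfRecord_of_pinned`. [folklore] -/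
theorem n14At_rateCarriersCmap_of_pinned (h : Ne1PinnedOfRecordCmap 𝔯) (F : T4Family) (θ : Stage13HParams F N)
    (hP : θ.Provisos₁₃CoPHChi F N (Χ F θ.toStage13Params)) (g₀ : ℕ → ℝ) (os : List (ULoop F)) (k : ℕ) :
    N14At (rateCarriersOfRecord₁₃CoPHCmap 𝔯 F θ hP g₀ os k).ne1 := by
  obtain ⟨l₀, Λ, hl₀, hΛ, hpin⟩ := h
  show N14At (𝔯.ne1 F θ hP g₀ os)
  rw [hpin F θ hP g₀ os]
  exact n14At_ne1OfRecordChi F θ _ hP g₀ os hl₀.le hΛ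

/-- **UNDER THE PIN: THE GUARD IN THE BUNDLE CURRENCY**: `Nondegenerate (rateCarriersOfRecord₁₃CoPHCmap 𝔯 F θ hP g₀ os k).ne1`. [folklore] -/
theorem nondegenerate_rateCarriersCmap_of_pinned (h : Ne1PinnedOfRecordCmap 𝔯) (F : T4Family) (θ : Stage13HParams F N)
    (hP : θ.Provisos₁₃CoPHChi F N (Χ F θ.toStage13Params)) (g₀ : ℕ → ℝ) (os : List (ULoop F)) (k : ℕ) :
    Nondegenerate (rateCarriersOfRecord₁₃CoPHCmap 𝔯 F θ hP g₀ os k).ne1 := by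
  obtain ⟨l₀, Λ, hl₀, -, hpin⟩ := h
  show Nondegenerate (𝔯.ne1 F θ hP g₀ os)
  rw [hpin F θ hP g₀ os]
  exact nondegenerate_ne1OfRecordChi F θ _ hP g₀ os hl₀

end Reading

end YMDAG.N14.TopBorn

end
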